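import Literature.NumberTheory.Rogawski1990.TamagawaSingularMembersFinTFCovol   -- ★ p844690: the letters' FRAME vocabulary (`LocalTransferFactor`, `ArchTransferFactor`, `cmRationalToArch`, `UnitaryGroup.cmDatum`)
import Literature.NumberTheory.Rogawski1990.ExplicitFactorProductFormula          -- ★ `UnitaryGroup.PlacesOver` idiom (split ∕ non-split places), the explicit factor's product formula
import HarnessLib

/-!
# `K2E4ExplicitKappaSignOfPhasePins` — the κ-SIGN BOOKKEEPING behind socket #14 `sig_K2E4ExplicitKappaSign`
# (Rogawski 1990, Prop. 8.2.1 (b) p. 118: «Part (b) follows from (a) and the product formula ΠΔ_{G_v∕H_v}(γ_{ov}) = 1 for γ₀ ∈ M»)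

Track B ∕ K2-LIT, crux h413 = `stmt-HodgeConjecture-24833`, route of record `HCCMUnconditional`; prover seat `hodgecm-mathlib-K2E4-p14` (g0);
lane `--supports stmt-HodgeConjecture-24833` (count-neutral).  THEOREMS ONLY (no `def`, no `instance`, no notation, no named-fact hypothesis, no `sorry`).
Socket served: `sig_K2E4ExplicitKappaSign` of `Cruxes/H413/Lines/K2_E4_SingularTransferKappaSignSigsSingularProductFormula.lean` (:116), unit U2
«SingularProductFormula», whose conclusion is (κ-sign): «once `c v = 1` off a finite `S_c`, `cinf · ∏_{v ∈ S_c} c v` is a POSITIVE REAL».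

**What is proved (kernel-checked, elementary).**

* `kappaSign_bookkeeping` — the pure algebra of Prop. 8.2.1 (b) ⟸ (a) + product formula, over any index type `ι` of «finite places»:
  if every finite constant is PINNED IN PHASE against the local factor at the singular pair — `c v · δ v = ∓ r_v` (`r_v > 0`, the sign `−`
  exactly on a set `A`, the places where the Kottwitz sign `e(G′_{γ₀,v}) = −1`) —, the archimedean constant is pinned as
  `cinf · δ_∞ = (−1)^{n_B} · r_∞` (`r_∞ > 0`, `n_B` = number of infinite places with `e = −1`), the factors at the pair are `1` almost
  everywhere and satisfy the product formula `(∏_{v ∈ S} δ v) · δ_∞ = 1` for every finite `S` off which `δ = 1`, and the Kottwitz-sign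
  PARITY `Even (#A + n_B)` holds, then (κ-sign) holds: `cinf · ∏_{v ∈ S_c} c v = r_∞ · ∏ r_v > 0`.
* `explicitKappaSign_of_phasePins` — the same sentence AT THE LETTERS' OBJECTS: `δ v = Δ‴_v(γ_{H,v}, γ_{0,v})` (a local transfer-factor
  collection `Δ` read at the semiregular pair), `δ_∞ = Tinf.Δ(γ_H ⊗ 1, γ₀ ⊗ 1)`, `A` = {finite non-split `v` at which the `e₁`-eigenplane
  `W₂(γ₀) = ker(γ₀ − e₁)` is anisotropic}, `n_B` = #{infinite `w` at which `W₂(γ₀)` is definite}; its three «global» hypotheses are the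
  conclusions of the unit's sockets #16 `sig_K2E4ExplicitSingularPairAlmostEverywhereOne`, #17 `sig_K2E4ExplicitSingularPairProductFormula`,
  #18 `sig_K2E4KottwitzSignParity` TOKEN FOR TOKEN, and its conclusion is the (κ-sign) tail of #14 TOKEN FOR TOKEN.  So the by-name file
  `Theorems/K2E4ExplicitKappaSign.lean` is `explicitKappaSign_of_phasePins` applied to #16 ∕ #17 ∕ #18 and to the two PHASE PINS of the
  given constants `c`, `cinf` — which is exactly what print's «(b) follows from (a) and the product formula» says: (a) pins every local
  constant against `Δ_{G_v∕H_v}(γ₀)` with compatible measures (the |ω|_v-partners differ from compatible measures by positive volumes and the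
  κ-value of the explicit factor at the pair carries the sign of the sheet of `γ_{0,v}`, print's `(−1)^{q(I(j))}` [(8.1.1) p. 117] and
  «the constant in the limit formula for H′ differs by a sign» [p. 119]).

**What is NOT proved here (the two phase pins; census for the dealer).**  (PIN-fin) for the GIVEN `c` needs sockets #2
`sig_K2E4ExplicitSplitConstantPhase` (split `v`: `+r`) and #8 `sig_K2E4KottwitzSignOfSheets` (non-split `v`: `∓r` by anisotropy of `W₂(γ₀)_v`)
— both stated for the |ω|_v-TAMAGAWA partners `finTamagawaPartner` — plus, because #14 quantifies over an ARBITRARY coherent singular system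
`(mGs₀, tGs₀)` with (Q-fin)₀ (COH-fin)₀ (LEV)₀, a transport «`c v = κ_v⁻¹ · c^ω_v` with `κ_v > 0` the Haar ratio `tGs₀ ∕ |ω_β|_v` on the class
of `γ_{0,v}`» (★ `IsQuotientOf.exists_eq_nnreal_smul` + ONE smooth transfer pair charging only the class of `γ_{0,v}`; (COH-fin)₀ does not
relate the two sheets of the local stable class at a non-split `v`, so the ratio must be read on a single-sheet test function).
(PIN-arch) for the GIVEN `cinf` needs #13 `sig_K2E4ArchTransferValueNonvanishing` (uniqueness of `cinf`) and a SIGNED form of #10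
`sig_K2E4ExplicitArchConstantPhase`: #10 as typed gives `cinf · Tinf.Δ(…) = r`, `r ≠ 0` real, but (κ-sign) needs its SIGN `(−1)^{n_B}`
(print p. 119: the limit-formula constant is `c` on the `H`-sheet and `−c` on the compact `H′`-sheet) — with `r ≠ 0` only, the parity #18
cannot be applied and (κ-sign) does not follow from the unit's sockets.  Reported to the dealer K2E4-plan ∕ chair K2-lead as socket gap «#10♯».

HONEST LABEL: HC_CM is proved only modulo the 7 printed citations (2 remaining named inputs: hLiu418 = `stmt-HodgeConjecture-24832`, h413 =
`stmt-HodgeConjecture-24833`) until rung 0 closes; this file moves no counter — it is the sorry-free composition step of socket #14.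

## References
* [Rogawski1990] J. D. Rogawski, *Automorphic Representations of Unitary Groups in Three Variables*, Ann. of Math. Stud. 123 (1990): §8.2
  Prop. 8.2.1 (a), (b) p. 118 and its proof p. 119; §8.1 (8.1.1)–(8.1.2) p. 117; §4.3 (4.3.1) p. 43; §14.5 Lemma 14.5.2 (b) pp. 238–239
  (held scan `book:rogawski1990-automorphic-representations-unitary-groups-three-variables`, p0117.txt:L12, p0118.txt:L32).
* [LanglandsShelstad1987] R. P. Langlands, D. Shelstad, *On the definition of transfer factors*, Math. Ann. 278 (1987), §6.4 Cor. 6.4.B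
  (global product formula).
* [Kottwitz1988] R. E. Kottwitz, *Tamagawa numbers*, Ann. of Math. 127 (1988), §1 (`∏_v e(G_v) = 1`).
-/

set_option autoImplicit false
-- the mandated namespace repeats the single-problem summit's segment (`HodgeConjecture.HodgeConjecture`)
set_option linter.dupNamespace false

noncomputable section

open MeasureTheory Measure NumberField IsDedekindDomain
open Literature.NumberTheory.Rogawski1990 Literature.NumberTheory.Automorphic
open Literature.AlgebraicGeometry.ShimuraVarieties (unitaryGroup hermForm)
open scoped Matrix MatrixGroups

namespace Summit.HodgeConjecture.HodgeConjecture.Cruxes.H413.K2E4ExplicitKappaSignOfPhasePins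

/-! ## §1 The bookkeeping (pure algebra over an index type of finite places) -/

/-- **κ-SIGN BOOKKEEPING** (Prop. 8.2.1 (b) ⟸ (a) + the product formula, as algebra).  Index type `ι` («finite places»), finite
constants `c : ι → ℂ`, local factors at the singular pair `δ : ι → ℂ`, the Kottwitz-sign predicate `A` («`e(G′_{γ₀,v}) = −1`»), the
archimedean constant `cinf`, factor `δinf` and sign count `nB`.  IF (PIN-fin) `∀ v, ∃ r > 0, (A v → c v · δ v = −r) ∧ (¬ A v → c v · δ v = r)`,
(PIN-arch) `∃ r > 0, cinf · δinf = (−1)^{nB} · r`, (AE) `δ v = 1` for almost all `v`, (PF) `(∏_{v ∈ S} δ v) · δinf = 1` whenever `δ = 1` off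
the finite `S`, and (PAR) `Even (#{v | A v} + nB)`, THEN (κ-sign): whenever `c v = 1` off a finite `S_c`, `cinf · ∏_{v ∈ S_c} c v` is a positive
real.  Proof: enlarge `S_c` to `S = S_c ∪ {δ ≠ 1}`; off `S`, `c v · δ v = 1 > 0` forces `¬ A v`, so `{A} ⊆ S` is finite; then
`(cinf · ∏_S c) · ((∏_S δ) · δinf) = (cinf · δinf) · ∏_S (c · δ) = (−1)^{nB + #{A}} · r_∞ · ∏_S r_v`, and (PF), (PAR) finish.
[cite: Rogawski1990, §8.2 Prop. 8.2.1 (b) p. 118] -/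
theorem kappaSign_bookkeeping {ι : Type*} (c δ : ι → ℂ) (A : ι → Prop) (cinf δinf : ℂ) (nB : ℕ)
    (hfin : ∀ v, ∃ r : ℝ, 0 < r ∧ (A v → c v * δ v = -(r : ℂ)) ∧ (¬ A v → c v * δ v = (r : ℂ)))
    (hinf : ∃ r : ℝ, 0 < r ∧ cinf * δinf = (-1) ^ nB * (r : ℂ))
    (hae : ∀ᶠ v in Filter.cofinite, δ v = 1)
    (hpf : ∀ S : Finset ι, (∀ v ∉ S, δ v = 1) → (∏ v ∈ S, δ v) * δinf = 1)
    (hpar : Even (Set.ncard {v | A v} + nB)) :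
    ∀ S_c : Finset ι, (∀ v ∉ S_c, c v = 1) → ∃ r : ℝ, 0 < r ∧ cinf * ∏ v ∈ S_c, c v = (r : ℂ) := by
  classical
  intro S_c hSc
  choose r hr0 hrA hrnA using hfin
  obtain ⟨rinf, hrinf0, hrinf⟩ := hinf
  have hD : {v | ¬ δ v = 1}.Finite := Filter.eventually_cofinite.1 hae
  set S : Finset ι := S_c ∪ hD.toFinset with hSdef
  have hS : ∀ v ∉ S, c v = 1 ∧ δ v = 1 := by
    intro v hv
    simp only [hSdef, Finset.mem_union, Set.Finite.mem_toFinset, Set.mem_setOf_eq, not_or, not_not] at hv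
    exact ⟨hSc v hv.1, hv.2⟩
  -- `{A} ⊆ S`: off `S` the product `c v * δ v = 1` is positive, so `¬ A v`
  have hAS : ∀ v, A v → v ∈ S := by
    intro v hvA
    by_contra hvS
    have h1 := hrA v hvA
    rw [(hS v hvS).1, (hS v hvS).2, one_mul] at h1
    have h2 : (1 : ℝ) = -r v := by exact_mod_cast h1
    linarith [hr0 v]
  have hAeq : {v | A v} = ↑(S.filter A) := by
    ext v
    simp only [Finset.coe_filter, Set.mem_setOf_eq]
    exact ⟨fun h => ⟨hAS v h, h⟩, fun h => h.2⟩
  have hAcard : Set.ncard {v | A v} = (S.filter A).card :=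
    (congrArg Set.ncard hAeq).trans (Set.ncard_coe_finset _)
  have hprodS : cinf * ∏ v ∈ S_c, c v = cinf * ∏ v ∈ S, c v := by
    congr 1
    exact Finset.prod_subset Finset.subset_union_left (fun v _ hvSc => hSc v hvSc)
  have hpfS : (∏ v ∈ S, δ v) * δinf = 1 := hpf S (fun v hv => (hS v hv).2)
  have hcd : ∀ v, c v * δ v = (if A v then (-1 : ℂ) else 1) * (r v : ℂ) := by
    intro v
    by_cases hv : A v
    · rw [if_pos hv, hrA v hv]; ring
    · rw [if_neg hv, hrnA v hv]; ring
  have hsignprod : ∏ v ∈ S, (if A v then (-1 : ℂ) else 1) = (-1) ^ (S.filter A).card := by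
    rw [Finset.prod_ite, Finset.prod_const_one, mul_one, Finset.prod_const]
  have key : (cinf * ∏ v ∈ S, c v) * ((∏ v ∈ S, δ v) * δinf) = (cinf * δinf) * ∏ v ∈ S, (c v * δ v) := by
    rw [Finset.prod_mul_distrib]; ring
  rw [hpfS, mul_one, hrinf, Finset.prod_congr rfl (fun v _ => hcd v), Finset.prod_mul_distrib, hsignprod] at key
  have hpow : ((-1 : ℂ) ^ nB) * (-1) ^ (S.filter A).card = 1 := by
    rw [← pow_add, add_comm, ← hAcard]; exact hpar.neg_one_pow
  refine ⟨rinf * ∏ v ∈ S, r v, mul_pos hrinf0 (Finset.prod_pos fun v _ => hr0 v), ?_⟩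
  rw [hprodS, key]
  push_cast
  linear_combination ((rinf : ℂ) * ∏ v ∈ S, (r v : ℂ)) * hpow

/-! ## §2 The bookkeeping at the letters' objects: (κ-sign) of socket #14 from the two phase pins and the tails of sockets #16, #17, #18 -/

section Frame

variable (L : Type) [Field L] [NumberField L] [IsCMField L] (H' : Matrix (Fin 3) (Fin 3) L) (Tinf : ArchTransferFactor L H')

/-- **(κ-sign) OF SOCKET #14 `sig_K2E4ExplicitKappaSign` FROM THE PHASE PINS** — Prop. 8.2.1 (b) ⟸ (a) + «ΠΔ_{G_v∕H_v}(γ_{ov}) = 1» at the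
letters' objects.  Data: a finite transfer-factor collection `Δ` and an archimedean one `Tinf` (in #14: the explicit `Δ‴`, `Δ‴_∞`), the
rational singular `γ₀ ∈ U(H′)(L)` with `e₁`-eigenplane `W₂(γ₀) = ker(γ₀ − e₁)`, the endoscopic element `γ_H ∈ (U(Φ₂) × U(Φ₁))(L)`, finite
constants `c` and the archimedean constant `cinf`.  Hypotheses: (PIN-fin) at every finite `v`, `c v · Δ_v(γ_{H,v}, γ_{0,v}) = −r` (`r > 0`)
if `v` is non-split in `L` (`Subsingleton (PlacesOver L v)`) and `W₂(γ₀) ⊗ L⁺_v` is anisotropic, `= +r` otherwise (the shape of sockets #2 ∕ #8);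
(PIN-arch) `cinf · Tinf.Δ(γ_H ⊗ 1, γ₀ ⊗ 1) = (−1)^{#{w ∣ W₂(γ₀) ⊗_w ℂ definite}} · r` (`r > 0`); (AE) = the conclusion of #16
`sig_K2E4ExplicitSingularPairAlmostEverywhereOne`; (PF) = the conclusion of #17 `sig_K2E4ExplicitSingularPairProductFormula`; (PAR) = the
conclusion of #18 `sig_K2E4KottwitzSignParity` — each token for token.  Conclusion: the (κ-sign) tail of #14 token for token.
Proof: `kappaSign_bookkeeping`. [cite: Rogawski1990, §8.2 Prop. 8.2.1 (b) p. 118; §14.5 Lemma 14.5.2 (b) pp. 238–239]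
[cite: LanglandsShelstad1987, §6.4 Cor. 6.4.B] -/
theorem explicitKappaSign_of_phasePins
    (Δ : ∀ v : HeightOneSpectrum (𝓞 ↥(maximalRealSubfield L)), LocalTransferFactor L H' v)
    (γ₀ : (UnitaryGroup.cmDatum L 3 H').Rational) (e₁ : L)
    (γH : (UnitaryGroup.cmDatum L 2 (Matrix.of fun i j : Fin 2 => if i.val + j.val + 1 = 2 then (1 : L) else 0)).Rational ×
      (UnitaryGroup.cmDatum L 1 (Matrix.of fun i j : Fin 1 => if i.val + j.val + 1 = 1 then (1 : L) else 0)).Rational)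
    (c : HeightOneSpectrum (𝓞 ↥(maximalRealSubfield L)) → ℂ) (cinf : ℂ)
    -- (PIN-fin): the finite constants against `Δ_v` at the pair, signed by the anisotropy of `W₂(γ₀)` at the non-split places
    (hfin : ∀ v : HeightOneSpectrum (𝓞 ↥(maximalRealSubfield L)), ∃ r : ℝ, 0 < r ∧
      ((Subsingleton (UnitaryGroup.PlacesOver L v) ∧
          (∀ x : Fin 3 → UnitaryGroup.LocalRing L v,
            Matrix.mulVec (((((γ₀ : unitaryGroup (cmConjRingHom L) H').val : GL (Fin 3) L) : Matrix (Fin 3) (Fin 3) L)).map (algebraMap L (UnitaryGroup.LocalRing L v)) -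
                algebraMap L (UnitaryGroup.LocalRing L v) e₁ • (1 : Matrix (Fin 3) (Fin 3) (UnitaryGroup.LocalRing L v))) x = 0 →
            (∑ i, ∑ j, UnitaryGroup.conjLocal L (IsCMField.complexConj L) v (x i) * algebraMap L (UnitaryGroup.LocalRing L v) (H' i j) * x j) = 0 →
            x = 0)) →
        c v * (Δ v).Δ ((UnitaryGroup.cmDatum L 2 (Matrix.of fun i j : Fin 2 => if i.val + j.val + 1 = 2 then (1 : L) else 0)).toLocal v ((UnitaryGroup.cmDatum L 2 (Matrix.of fun i j : Fin 2 => if i.val + j.val + 1 = 2 then (1 : L) else 0)).toAdelic γH.1),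
              (UnitaryGroup.cmDatum L 1 (Matrix.of fun i j : Fin 1 => if i.val + j.val + 1 = 1 then (1 : L) else 0)).toLocal v ((UnitaryGroup.cmDatum L 1 (Matrix.of fun i j : Fin 1 => if i.val + j.val + 1 = 1 then (1 : L) else 0)).toAdelic γH.2)) ((UnitaryGroup.cmDatum L 3 H').toLocal v ((UnitaryGroup.cmDatum L 3 H').toAdelic γ₀)) = -(r : ℂ)) ∧
      (¬ (Subsingleton (UnitaryGroup.PlacesOver L v) ∧
          (∀ x : Fin 3 → UnitaryGroup.LocalRing L v,
            Matrix.mulVec (((((γ₀ : unitaryGroup (cmConjRingHom L) H').val : GL (Fin 3) L) : Matrix (Fin 3) (Fin 3) L)).map (algebraMap L (UnitaryGroup.LocalRing L v)) -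
                algebraMap L (UnitaryGroup.LocalRing L v) e₁ • (1 : Matrix (Fin 3) (Fin 3) (UnitaryGroup.LocalRing L v))) x = 0 →
            (∑ i, ∑ j, UnitaryGroup.conjLocal L (IsCMField.complexConj L) v (x i) * algebraMap L (UnitaryGroup.LocalRing L v) (H' i j) * x j) = 0 →
            x = 0)) →
        c v * (Δ v).Δ ((UnitaryGroup.cmDatum L 2 (Matrix.of fun i j : Fin 2 => if i.val + j.val + 1 = 2 then (1 : L) else 0)).toLocal v ((UnitaryGroup.cmDatum L 2 (Matrix.of fun i j : Fin 2 => if i.val + j.val + 1 = 2 then (1 : L) else 0)).toAdelic γH.1),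
              (UnitaryGroup.cmDatum L 1 (Matrix.of fun i j : Fin 1 => if i.val + j.val + 1 = 1 then (1 : L) else 0)).toLocal v ((UnitaryGroup.cmDatum L 1 (Matrix.of fun i j : Fin 1 => if i.val + j.val + 1 = 1 then (1 : L) else 0)).toAdelic γH.2)) ((UnitaryGroup.cmDatum L 3 H').toLocal v ((UnitaryGroup.cmDatum L 3 H').toAdelic γ₀)) = (r : ℂ)))
    -- (PIN-arch): the archimedean constant against `Tinf.Δ` at the pair, signed by the number of infinite places at which `W₂(γ₀)` is definite
    (hinf : ∃ r : ℝ, 0 < r ∧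
      cinf * Tinf.Δ (cmRationalToArch L 2 (Matrix.of fun i j : Fin 2 => if i.val + j.val + 1 = 2 then (1 : L) else 0) γH.1, cmRationalToArch L 1 (Matrix.of fun i j : Fin 1 => if i.val + j.val + 1 = 1 then (1 : L) else 0) γH.2) (cmRationalToArch L 3 H' γ₀) =
        (-1) ^ Set.ncard {w : NumberField.InfinitePlace L |
                    (∀ x : Fin 3 → ℂ,
                      Matrix.mulVec (((((γ₀ : unitaryGroup (cmConjRingHom L) H').val : GL (Fin 3) L) : Matrix (Fin 3) (Fin 3) L)).map w.embedding - w.embedding e₁ • (1 : Matrix (Fin 3) (Fin 3) ℂ)) x = 0 →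
                      (∑ i, ∑ j, starRingEnd ℂ (x i) * w.embedding (H' i j) * x j) = 0 → x = 0)} * (r : ℂ))
    -- (AE) = conclusion of socket #16 `sig_K2E4ExplicitSingularPairAlmostEverywhereOne`, token for token
    (hae : ∀ᶠ v : HeightOneSpectrum (𝓞 ↥(maximalRealSubfield L)) in Filter.cofinite, (Δ v).Δ ((UnitaryGroup.cmDatum L 2 (Matrix.of fun i j : Fin 2 => if i.val + j.val + 1 = 2 then (1 : L) else 0)).toLocal v ((UnitaryGroup.cmDatum L 2 (Matrix.of fun i j : Fin 2 => if i.val + j.val + 1 = 2 then (1 : L) else 0)).toAdelic γH.1),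
                            (UnitaryGroup.cmDatum L 1 (Matrix.of fun i j : Fin 1 => if i.val + j.val + 1 = 1 then (1 : L) else 0)).toLocal v ((UnitaryGroup.cmDatum L 1 (Matrix.of fun i j : Fin 1 => if i.val + j.val + 1 = 1 then (1 : L) else 0)).toAdelic γH.2)) ((UnitaryGroup.cmDatum L 3 H').toLocal v ((UnitaryGroup.cmDatum L 3 H').toAdelic γ₀)) = 1)
    -- (PF) = conclusion of socket #17 `sig_K2E4ExplicitSingularPairProductFormula`, token for token
    (hpf : ∀ S : Finset (HeightOneSpectrum (𝓞 ↥(maximalRealSubfield L))), (∀ v ∉ S, (Δ v).Δ ((UnitaryGroup.cmDatum L 2 (Matrix.of fun i j : Fin 2 => if i.val + j.val + 1 = 2 then (1 : L) else 0)).toLocal v ((UnitaryGroup.cmDatum L 2 (Matrix.of fun i j : Fin 2 => if i.val + j.val + 1 = 2 then (1 : L) else 0)).toAdelic γH.1),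
                            (UnitaryGroup.cmDatum L 1 (Matrix.of fun i j : Fin 1 => if i.val + j.val + 1 = 1 then (1 : L) else 0)).toLocal v ((UnitaryGroup.cmDatum L 1 (Matrix.of fun i j : Fin 1 => if i.val + j.val + 1 = 1 then (1 : L) else 0)).toAdelic γH.2)) ((UnitaryGroup.cmDatum L 3 H').toLocal v ((UnitaryGroup.cmDatum L 3 H').toAdelic γ₀)) = 1) →
                    (∏ v ∈ S, (Δ v).Δ ((UnitaryGroup.cmDatum L 2 (Matrix.of fun i j : Fin 2 => if i.val + j.val + 1 = 2 then (1 : L) else 0)).toLocal v ((UnitaryGroup.cmDatum L 2 (Matrix.of fun i j : Fin 2 => if i.val + j.val + 1 = 2 then (1 : L) else 0)).toAdelic γH.1),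
                            (UnitaryGroup.cmDatum L 1 (Matrix.of fun i j : Fin 1 => if i.val + j.val + 1 = 1 then (1 : L) else 0)).toLocal v ((UnitaryGroup.cmDatum L 1 (Matrix.of fun i j : Fin 1 => if i.val + j.val + 1 = 1 then (1 : L) else 0)).toAdelic γH.2)) ((UnitaryGroup.cmDatum L 3 H').toLocal v ((UnitaryGroup.cmDatum L 3 H').toAdelic γ₀))) * Tinf.Δ (cmRationalToArch L 2 (Matrix.of fun i j : Fin 2 => if i.val + j.val + 1 = 2 then (1 : L) else 0) γH.1, cmRationalToArch L 1 (Matrix.of fun i j : Fin 1 => if i.val + j.val + 1 = 1 then (1 : L) else 0) γH.2) (cmRationalToArch L 3 H' γ₀) = 1)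
    -- (PAR) = conclusion of socket #18 `sig_K2E4KottwitzSignParity`, token for token
    (hpar : Even (Set.ncard {v : HeightOneSpectrum (𝓞 ↥(maximalRealSubfield L)) | Subsingleton (UnitaryGroup.PlacesOver L v) ∧
                    (∀ x : Fin 3 → UnitaryGroup.LocalRing L v,
                      Matrix.mulVec (((((γ₀ : unitaryGroup (cmConjRingHom L) H').val : GL (Fin 3) L) : Matrix (Fin 3) (Fin 3) L)).map (algebraMap L (UnitaryGroup.LocalRing L v)) -
                          algebraMap L (UnitaryGroup.LocalRing L v) e₁ • (1 : Matrix (Fin 3) (Fin 3) (UnitaryGroup.LocalRing L v))) x = 0 →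
                      (∑ i, ∑ j, UnitaryGroup.conjLocal L (IsCMField.complexConj L) v (x i) * algebraMap L (UnitaryGroup.LocalRing L v) (H' i j) * x j) = 0 →
                      x = 0)} +
                    Set.ncard {w : NumberField.InfinitePlace L |
                    (∀ x : Fin 3 → ℂ,
                      Matrix.mulVec (((((γ₀ : unitaryGroup (cmConjRingHom L) H').val : GL (Fin 3) L) : Matrix (Fin 3) (Fin 3) L)).map w.embedding - w.embedding e₁ • (1 : Matrix (Fin 3) (Fin 3) ℂ)) x = 0 →
                      (∑ i, ∑ j, starRingEnd ℂ (x i) * w.embedding (H' i j) * x j) = 0 → x = 0)})) :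
    -- (κ-sign) = the tail of socket #14 `sig_K2E4ExplicitKappaSign`, token for token
    ∀ S_c : Finset (HeightOneSpectrum (𝓞 ↥(maximalRealSubfield L))), (∀ v ∉ S_c, c v = 1) →
      ∃ r : ℝ, 0 < r ∧ cinf * ∏ v ∈ S_c, c v = (r : ℂ) :=
  kappaSign_bookkeeping c
    (fun v => (Δ v).Δ ((UnitaryGroup.cmDatum L 2 (Matrix.of fun i j : Fin 2 => if i.val + j.val + 1 = 2 then (1 : L) else 0)).toLocal v ((UnitaryGroup.cmDatum L 2 (Matrix.of fun i j : Fin 2 => if i.val + j.val + 1 = 2 then (1 : L) else 0)).toAdelic γH.1),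
              (UnitaryGroup.cmDatum L 1 (Matrix.of fun i j : Fin 1 => if i.val + j.val + 1 = 1 then (1 : L) else 0)).toLocal v ((UnitaryGroup.cmDatum L 1 (Matrix.of fun i j : Fin 1 => if i.val + j.val + 1 = 1 then (1 : L) else 0)).toAdelic γH.2)) ((UnitaryGroup.cmDatum L 3 H').toLocal v ((UnitaryGroup.cmDatum L 3 H').toAdelic γ₀)))
    (fun v => Subsingleton (UnitaryGroup.PlacesOver L v) ∧
          (∀ x : Fin 3 → UnitaryGroup.LocalRing L v,
            Matrix.mulVec (((((γ₀ : unitaryGroup (cmConjRingHom L) H').val : GL (Fin 3) L) : Matrix (Fin 3) (Fin 3) L)).map (algebraMap L (UnitaryGroup.LocalRing L v)) -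
                algebraMap L (UnitaryGroup.LocalRing L v) e₁ • (1 : Matrix (Fin 3) (Fin 3) (UnitaryGroup.LocalRing L v))) x = 0 →
            (∑ i, ∑ j, UnitaryGroup.conjLocal L (IsCMField.complexConj L) v (x i) * algebraMap L (UnitaryGroup.LocalRing L v) (H' i j) * x j) = 0 →
            x = 0))
    cinf
    (Tinf.Δ (cmRationalToArch L 2 (Matrix.of fun i j : Fin 2 => if i.val + j.val + 1 = 2 then (1 : L) else 0) γH.1, cmRationalToArch L 1 (Matrix.of fun i j : Fin 1 => if i.val + j.val + 1 = 1 then (1 : L) else 0) γH.2) (cmRationalToArch L 3 H' γ₀))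
    (Set.ncard {w : NumberField.InfinitePlace L |
                    (∀ x : Fin 3 → ℂ,
                      Matrix.mulVec (((((γ₀ : unitaryGroup (cmConjRingHom L) H').val : GL (Fin 3) L) : Matrix (Fin 3) (Fin 3) L)).map w.embedding - w.embedding e₁ • (1 : Matrix (Fin 3) (Fin 3) ℂ)) x = 0 →
                      (∑ i, ∑ j, starRingEnd ℂ (x i) * w.embedding (H' i j) * x j) = 0 → x = 0)})
    hfin hinf hae hpf hpar

end Frame

end Summit.HodgeConjecture.HodgeConjecture.Cruxes.H413.K2E4ExplicitKappaSignOfPhasePins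

end
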